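import Summits.Ventures.LatticeQCDFlow.Exactness.BernsteinInequality
import Summits.Ventures.LatticeQCDFlow.Exactness.IMHCoupledEstimatorBurnInHoeffding
import HarnessLib

/-!
# An empirical Bernstein certificate: the error bar computed from the replicas' own scatter is honest —
# `P(|H̄_R − π f| ≥ √(2ℓ(Q̂_R + s)/R) + 2(c − a)ℓ/(3R) + r^k(c − a)) ≤ 2e^{−ℓ} + exp(−Rs²/(2(c − a)⁴)) + R·r^k·p₀`

HONEST FRAMING: exact (Metropolis-corrected) sampling algorithms for lattice gauge theory;
figures of merit are autocorrelation/cost numbers at stated couplings and volumes; no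
continuum-physics claim.

Venture `LatticeQCDFlow` (cell pub-lqcd), topic `Exactness`; FANOUT row 30 (lean-1, GEN-40).  NEW WORK of the cell; sequel to this
generation's `Exactness/BernsteinInequality` ∕ `…IMHCoupledEstimatorBernstein` (Bernstein bars with a KNOWN variance bound `σ²`;
«NOT CLAIMED: an empirical-variance (data-driven σ²) certificate»).  Here the variance bound is READ OFF THE DATA: for a reference value
`θ ∈ [a, c]` declared in advance, the mean square scatter `Q̂_R = R⁻¹Σ_{j<R}(X_j − θ)²` of the replicas about `θ` over-estimates the common
second moment `Q = E(X_j − θ)² = Var X_j + (m − θ)² ≥ Var X_j` up to a Hoeffding slack, and the Bernstein radius is monotone in the variance: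

* §1 (generic, [ours]) **`bernstein_radius_exponent_le`** — with `t = √(2ℓσ²/R) + 2bℓ/(3R)` (`ℓ, σ², b ≥ 0`, `R ≥ 1`):
  `exp(−Rt²/(2(σ² + bt/3))) ≤ e^{−ℓ}` [algebra]; **`bernstein_avg_abs_radius`** — `P(|R⁻¹Σ_{j<R} X_j − m| ≥ √(2ℓσ²/R) + 2bℓ/(3R)) ≤ 2e^{−ℓ}`
  for mutually independent measurable `X_j` with common mean `m`, `|X_j − m| ≤ b`, `Var X_j ≤ σ²` (`σ² > 0`);
  **`empirical_bernstein_certificate`** — THE EMPIRICAL CERTIFICATE: `X_j ∈ [a, c]` mutually independent with common mean `m` and common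
  second moment `Q` about a fixed `θ ∈ [a, c]`; for `ℓ ≥ 0`, `s > 0`, `R ≥ 1`:
  `P(|R⁻¹Σ_j X_j − m| ≥ √(2ℓ(Q̂_R + s)/R) + 2(c − a)ℓ/(3R)) ≤ 2e^{−ℓ} + exp(−Rs²/(2(c − a)⁴))`
  (Bernstein at `σ² = Q + s/2`, Hoeffding's lower tail for the `(X_j − θ)² ∈ [0, (c − a)²]` at slack `s/2`, monotonicity of the radius).
* §2 **`crnLag_replicas_readout_empirical_certificate`** — the same for the read-outs `f(Y_k^{(j)})` of `R` mutually independent pair streams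
  with the common law of the pair chain (common mean `m_k = (ν₂K^k) f`, common `Q`); **`crnLag_replicas_burnIn_empirical_certificate_target`** —
  ABOUT `π f`, for the coupled estimates `H_{k,N}(Z_j)` after `k` burn-in updates (`MeasurableEq Ω`, `w` maximal at `x₀`, `r = 1 − 1/w(x₀)`,
  `p₀ = ν̂(Δᶜ)`): `P(|H̄_R − π f| ≥ √(2ℓ(Q̂_R + s)/R) + 2(c − a)ℓ/(3R) + r^k(c − a)) ≤ 2e^{−ℓ} + exp(−Rs²/(2(c − a)⁴)) + R·r^k·p₀`, where
  `Q̂_R = R⁻¹Σ_j(f(Y_k^{(j)}) − θ)²` is computed from the same read-outs — EVERY QUANTITY IN THE RADIUS IS PRINTED BY THE RUN; the closer the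
  declared `θ` to `π f`, the closer `Q` to `Var_{ν₂K^k} f ≤ Var_π f + 3r^k(c − a)²` (this generation's `variance_iterate_bind_indepMH_le`).
Reading (gauge files): `R` independent coupled pairs of two exact gauge samplers certify a bounded observable by their own scatter: with
`ℓ = log(4/δ)` and `s = (c − a)²√(2log(2/δ)/R)` the displayed radius fails with probability at most `δ + R(1 − A)^k p₀`.
NOT CLAIMED: the sample-variance (`θ = X̄_R`, U-statistic) version à la Maurer–Pontil ∕ Audibert–Munos–Szepesvári (named only), which needs
the independence of disjoint blocks; time-averaged windows (the sequel `…TimeAverageBernstein` has the known-variance form); unbounded `f`;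
any value of `A`.  No `sorry`, no new definitions, nothing cited as a fact.
-/

noncomputable section

namespace Summit.Ventures.LatticeQCDFlow.Exactness

open MeasureTheory ProbabilityTheory Function Finset Filter
open scoped ENNReal unitInterval Topology NNReal
open Summit.Ventures.LatticeQCDFlow.Scoring

variable {Ω : Type*} [MeasurableSpace Ω] {q : Measure Ω} [IsProbabilityMeasure q] {w : Ω → ℝ}

/-! ## §1 The empirical Bernstein certificate (generic) -/

section Generic

variable {Ω' : Type*} {mΩ' : MeasurableSpace Ω'} {μ : Measure Ω'} [IsProbabilityMeasure μ] {X : ℕ → Ω' → ℝ}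

omit [IsProbabilityMeasure μ] in
/-- **The Bernstein radius solves the exponent**: `t = √(2ℓσ²/R) + 2bℓ/(3R)` with `ℓ, σ², b ≥ 0`, `R ≥ 1` gives
`exp(−Rt²/(2(σ² + bt/3))) ≤ e^{−ℓ}` (indeed `Rt² ≥ 2ℓ(σ² + bt/3)`). [ours, algebra] -/
theorem bernstein_radius_exponent_le {ℓ σ2 b : ℝ} (hℓ : 0 ≤ ℓ) (hσ : 0 < σ2) (hb : 0 ≤ b) {R : ℕ} (hR : 1 ≤ R) :
    Real.exp (-(R * (Real.sqrt (2 * ℓ * σ2 / R) + 2 * b * ℓ / (3 * R)) ^ 2) /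
        (2 * (σ2 + b * (Real.sqrt (2 * ℓ * σ2 / R) + 2 * b * ℓ / (3 * R)) / 3))) ≤ Real.exp (-ℓ) := by
  have hRpos : (0 : ℝ) < R := Nat.cast_pos.2 (by omega)
  set α := Real.sqrt (2 * ℓ * σ2 / R) with hα
  set β := 2 * b * ℓ / (3 * R) with hβ
  have hα0 : 0 ≤ α := Real.sqrt_nonneg _
  have hβ0 : 0 ≤ β := by positivity
  have hα2 : α ^ 2 = 2 * ℓ * σ2 / R := Real.sq_sqrt (by positivity)
  have hden : 0 < σ2 + b * (α + β) / 3 := by positivity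
  rw [Real.exp_le_exp, neg_div, neg_le_neg_iff, le_div_iff₀ (by positivity)]
  -- `ℓ·2(σ² + b(α+β)/3) ≤ R(α+β)²`
  have hRβ : (R : ℝ) * β = 2 * b * ℓ / 3 := by rw [hβ]; field_simp
  have hRα2 : (R : ℝ) * α ^ 2 = 2 * ℓ * σ2 := by rw [hα2]; field_simp
  nlinarith [mul_nonneg (mul_nonneg hb hℓ) hα0, mul_nonneg hα0 hβ0]

/-- **BERNSTEIN WITH THE RADIUS SPELLED OUT**: `P(|R⁻¹Σ_{j<R} X_j − m| ≥ √(2ℓσ²/R) + 2bℓ/(3R)) ≤ 2e^{−ℓ}`. [ours] -/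
theorem bernstein_avg_abs_radius (hXm : ∀ j, Measurable (X j)) (hind : iIndepFun X μ) {b : ℝ} (hb : 0 ≤ b) {m : ℝ}
    (hmean : ∀ j, μ[X j] = m) (hbd : ∀ j ω, |X j ω - m| ≤ b) {σ2 : ℝ} (hσ : 0 < σ2) (hvar : ∀ j, variance (X j) μ ≤ σ2)
    {ℓ : ℝ} (hℓ : 0 ≤ ℓ) {R : ℕ} (hR : 1 ≤ R) :
    μ.real {ω | Real.sqrt (2 * ℓ * σ2 / R) + 2 * b * ℓ / (3 * R) ≤ |(R : ℝ)⁻¹ * ∑ j ∈ range R, X j ω - m|} ≤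
      2 * Real.exp (-ℓ) := by
  have ht0 : 0 ≤ Real.sqrt (2 * ℓ * σ2 / R) + 2 * b * ℓ / (3 * R) := by positivity
  have h := bernstein_avg_abs hXm hind hmean hbd hσ hvar ht0 hR
  refine h.trans ?_
  have h2 := bernstein_radius_exponent_le hℓ hσ hb hR
  have hre : -(R * (Real.sqrt (2 * ℓ * σ2 / R) + 2 * b * ℓ / (3 * R)) ^ 2) /
        (2 * (σ2 + b * (Real.sqrt (2 * ℓ * σ2 / R) + 2 * b * ℓ / (3 * R)) / 3)) =
      -(↑R * (Real.sqrt (2 * ℓ * σ2 / R) + 2 * b * ℓ / (3 * R)) ^ 2) /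
        (2 * (σ2 + b * (Real.sqrt (2 * ℓ * σ2 / R) + 2 * b * ℓ / (3 * R)) / 3)) := rfl
  linarith

/-- **THE EMPIRICAL BERNSTEIN CERTIFICATE** (reference-value form): mutually independent measurable `X_j ∈ [a, c]` with a common mean `m`
and a common second moment `Q = E(X_j − θ)²` about a fixed reference value `θ ∈ [a, c]`; `Q̂_R = R⁻¹Σ_{j<R}(X_j − θ)²`; for `ℓ ≥ 0`,
`s > 0`, `R ≥ 1`: `P(|R⁻¹Σ_{j<R} X_j − m| ≥ √(2ℓ(Q̂_R + s)/R) + 2(c − a)ℓ/(3R)) ≤ 2e^{−ℓ} + exp(−Rs²/(2(c − a)⁴))`. [ours] -/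
theorem empirical_bernstein_certificate (hXm : ∀ j, Measurable (X j)) (hind : iIndepFun X μ) {a c : ℝ}
    (hbd : ∀ j ω, X j ω ∈ Set.Icc a c) {m : ℝ} (hmean : ∀ j, μ[X j] = m) {θ : ℝ} (hθ : θ ∈ Set.Icc a c)
    {Q : ℝ} (hQ : ∀ j, μ[fun ω => (X j ω - θ) ^ 2] = Q) {ℓ : ℝ} (hℓ : 0 ≤ ℓ) {s : ℝ} (hs : 0 < s) {R : ℕ} (hR : 1 ≤ R) :
    μ.real {ω | Real.sqrt (2 * ℓ * ((R : ℝ)⁻¹ * ∑ j ∈ range R, (X j ω - θ) ^ 2 + s) / R) + 2 * (c - a) * ℓ / (3 * R) ≤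
        |(R : ℝ)⁻¹ * ∑ j ∈ range R, X j ω - m|} ≤
      2 * Real.exp (-ℓ) + Real.exp (-(R * s ^ 2) / (2 * (c - a) ^ 4)) := by
  have hRpos : (0 : ℝ) < R := Nat.cast_pos.2 (by omega)
  have hca : 0 ≤ c - a := by linarith [hθ.1, hθ.2]
  -- the summands are square integrable with variance `≤ Q ≤ Q + s/2`
  have hXi : ∀ j, Integrable (X j) μ := fun j =>
    Integrable.of_bound (hXm j).aestronglyMeasurable (max |a| |c|) (ae_of_all _ fun ω => by
      rw [Real.norm_eq_abs]; exact abs_le_max_abs_abs (hbd j ω).1 (hbd j ω).2)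
  have hmem : ∀ j, MemLp (X j) 2 μ := fun j => memLp_of_bounded (ae_of_all _ (hbd j)) (hXm j).aestronglyMeasurable 2
  have hm_mem : a ≤ m ∧ m ≤ c := by
    constructor
    · rw [← hmean 0]
      calc a = ∫ _, a ∂μ := by simp
        _ ≤ μ[X 0] := integral_mono (integrable_const _) (hXi 0) fun ω => (hbd 0 ω).1
    · rw [← hmean 0]
      calc μ[X 0] ≤ ∫ _, c ∂μ := integral_mono (hXi 0) (integrable_const _) fun ω => (hbd 0 ω).2
        _ = c := by simp
  have habs : ∀ j ω, |X j ω - m| ≤ c - a := fun j ω =>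
    abs_sub_le_iff.2 ⟨by linarith [(hbd j ω).2, hm_mem.1], by linarith [(hbd j ω).1, hm_mem.2]⟩
  have hvarQ : ∀ j, variance (X j) μ ≤ Q := fun j => by
    have h := variance_le_integral_sub_sq (hmem j) θ
    rw [hQ j] at h
    exact h
  -- (E2) Bernstein at `σ² = Q + s/2`
  have hQ0 : 0 ≤ Q := by rw [← hQ 0]; exact integral_nonneg fun ω => sq_nonneg _
  have hσ : 0 < Q + s / 2 := by linarith
  have hB := bernstein_avg_abs_radius hXm hind hca hmean habs hσ (fun j => (hvarQ j).trans (by linarith)) hℓ hR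
  -- (E1) Hoeffding's lower tail for the scatter `(X_j − θ)² ∈ [0, (c − a)²]`
  have hSm : ∀ j, Measurable fun ω => (X j ω - θ) ^ 2 := fun j => ((hXm j).sub_const θ).pow_const 2
  have hSbd : ∀ j ω, (X j ω - θ) ^ 2 ∈ Set.Icc 0 ((c - a) ^ 2) := fun j ω => by
    refine ⟨sq_nonneg _, ?_⟩
    have h1 : |X j ω - θ| ≤ c - a := abs_sub_le_iff.2 ⟨by linarith [(hbd j ω).2, hθ.1], by linarith [(hbd j ω).1, hθ.2]⟩
    calc (X j ω - θ) ^ 2 = |X j ω - θ| ^ 2 := (sq_abs _).symm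
      _ ≤ (c - a) ^ 2 := pow_le_pow_left₀ (abs_nonneg _) h1 2
  have hH := hoeffding_avg_le_of_mem_Icc (X := fun j ω => (X j ω - θ) ^ 2) hSm
    (hind.comp (fun _ => fun x : ℝ => (x - θ) ^ 2) fun _ => (measurable_id.sub_const θ).pow_const 2) hSbd hQ
    (ε := s / 2) (by linarith) hR
  have hHexp : Real.exp (-(2 * R * (s / 2) ^ 2) / ((c - a) ^ 2 - 0) ^ 2) = Real.exp (-(R * s ^ 2) / (2 * (c - a) ^ 4)) := by
    congr 1
    rcases eq_or_ne (c - a) 0 with h0 | h0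
    · simp [h0]
    · field_simp
      ring
  rw [hHexp] at hH
  -- inclusion: off (E1) the empirical radius dominates the radius at `σ² = Q + s/2`
  have hsub : {ω | Real.sqrt (2 * ℓ * ((R : ℝ)⁻¹ * ∑ j ∈ range R, (X j ω - θ) ^ 2 + s) / R) + 2 * (c - a) * ℓ / (3 * R) ≤
        |(R : ℝ)⁻¹ * ∑ j ∈ range R, X j ω - m|} ⊆
      {ω | s / 2 ≤ Q - (R : ℝ)⁻¹ * ∑ j ∈ range R, (X j ω - θ) ^ 2} ∪
        {ω | Real.sqrt (2 * ℓ * (Q + s / 2) / R) + 2 * (c - a) * ℓ / (3 * R) ≤ |(R : ℝ)⁻¹ * ∑ j ∈ range R, X j ω - m|} := by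
    intro ω hω
    simp only [Set.mem_setOf_eq, Set.mem_union] at hω ⊢
    by_cases h1 : s / 2 ≤ Q - (R : ℝ)⁻¹ * ∑ j ∈ range R, (X j ω - θ) ^ 2
    · exact Or.inl h1
    · right
      have hle : Q + s / 2 ≤ (R : ℝ)⁻¹ * ∑ j ∈ range R, (X j ω - θ) ^ 2 + s := by linarith
      have hmono : Real.sqrt (2 * ℓ * (Q + s / 2) / R) ≤ Real.sqrt (2 * ℓ * ((R : ℝ)⁻¹ * ∑ j ∈ range R, (X j ω - θ) ^ 2 + s) / R) :=
        Real.sqrt_le_sqrt (div_le_div_of_nonneg_right (mul_le_mul_of_nonneg_left hle (by positivity)) hRpos.le)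
      linarith
  calc μ.real {ω | Real.sqrt (2 * ℓ * ((R : ℝ)⁻¹ * ∑ j ∈ range R, (X j ω - θ) ^ 2 + s) / R) + 2 * (c - a) * ℓ / (3 * R) ≤
          |(R : ℝ)⁻¹ * ∑ j ∈ range R, X j ω - m|}
      ≤ μ.real ({ω | s / 2 ≤ Q - (R : ℝ)⁻¹ * ∑ j ∈ range R, (X j ω - θ) ^ 2} ∪
          {ω | Real.sqrt (2 * ℓ * (Q + s / 2) / R) + 2 * (c - a) * ℓ / (3 * R) ≤ |(R : ℝ)⁻¹ * ∑ j ∈ range R, X j ω - m|}) :=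
        measureReal_mono hsub
    _ ≤ μ.real {ω | s / 2 ≤ Q - (R : ℝ)⁻¹ * ∑ j ∈ range R, (X j ω - θ) ^ 2} +
          μ.real {ω | Real.sqrt (2 * ℓ * (Q + s / 2) / R) + 2 * (c - a) * ℓ / (3 * R) ≤ |(R : ℝ)⁻¹ * ∑ j ∈ range R, X j ω - m|} :=
        measureReal_union_le _ _
    _ ≤ Real.exp (-(R * s ^ 2) / (2 * (c - a) ^ 4)) + 2 * Real.exp (-ℓ) := add_le_add hH hB
    _ = 2 * Real.exp (-ℓ) + Real.exp (-(R * s ^ 2) / (2 * (c - a) ^ 4)) := add_comm _ _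

end Generic

/-! ## §2 The coupled estimator: read-outs, then burn-in and the target `π f` -/

section Replicas

variable {Ω' : Type*} {mΩ' : MeasurableSpace Ω'} {μ : Measure Ω'} [IsProbabilityMeasure μ]
  {Z : ℕ → Ω' → (ℕ → Ω × Ω)}

/-- **THE EMPIRICAL CERTIFICATE FOR THE READ-OUTS `f(Y_k^{(j)})`**: `R` mutually independent pair streams with the common law of the pair chain,
`a ≤ f ≤ c` measurable, `θ ∈ [a, c]` fixed, `Q̂_R = R⁻¹Σ_j(f(Y_k^{(j)}) − θ)²`, `m_k = (ν₂K^k) f`; for `ℓ ≥ 0`, `s > 0`, `R ≥ 1`: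
`P(|R⁻¹Σ_j f(Y_k^{(j)}) − m_k| ≥ √(2ℓ(Q̂_R + s)/R) + 2(c − a)ℓ/(3R)) ≤ 2e^{−ℓ} + exp(−Rs²/(2(c − a)⁴))`. [ours] -/
theorem crnLag_replicas_readout_empirical_certificate [Fact (Measurable w)] (hw0 : ∀ y, 0 < w y)
    (Khat : Kernel (Ω × Ω) (Ω × Ω)) [IsMarkovKernel Khat]
    (hK : ∀ z : Ω × Ω, Khat z = (q.prod (volume : Measure unitInterval)).map (fun p : Ω × unitInterval =>
      ((if (p.2 : ℝ) * w z.1 ≤ w p.1 then p.1 else z.1), (if (p.2 : ℝ) * w z.2 ≤ w p.1 then p.1 else z.2))))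
    (ν : Measure (Ω × Ω)) [IsProbabilityMeasure ν] {f : Ω → ℝ} (hf : Measurable f) {a c : ℝ} (ha : ∀ x, a ≤ f x)
    (hc : ∀ x, f x ≤ c) (k : ℕ) (hZm : ∀ j, Measurable (Z j))
    (hlaw : ∀ j, μ.map (Z j) = Kernel.trajMeasure (X := fun _ : ℕ => Ω × Ω) ν
      (fun n : ℕ => Khat.comap (fun h : (i : ↥(Finset.Iic n)) → Ω × Ω => h ⟨n, Finset.mem_Iic.2 le_rfl⟩)
        (measurable_pi_apply _)))
    (hind : iIndepFun Z μ) {θ : ℝ} (hθ : θ ∈ Set.Icc a c) {ℓ : ℝ} (hℓ : 0 ≤ ℓ) {s : ℝ} (hs : 0 < s) {R : ℕ} (hR : 1 ≤ R) :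
    μ.real {ω | Real.sqrt (2 * ℓ * ((R : ℝ)⁻¹ * ∑ j ∈ range R, (f ((Z j ω k).2) - θ) ^ 2 + s) / R) + 2 * (c - a) * ℓ / (3 * R) ≤
        |(R : ℝ)⁻¹ * ∑ j ∈ range R, f ((Z j ω k).2) -
          ∫ y, f y ∂((fun m : Measure Ω => m.bind (indepMH q w))^[k] (ν.map Prod.snd))|} ≤
      2 * Real.exp (-ℓ) + Real.exp (-(R * s ^ 2) / (2 * (c - a) ^ 4)) := by
  have hFm : Measurable fun z : ℕ → Ω × Ω => f ((z k).2) := hf.comp (measurable_snd.comp (measurable_pi_apply k))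
  have hC : ∀ x, |f x| ≤ max |a| |c| := fun x => abs_le_max_abs_abs (ha x) (hc x)
  set mk := ∫ y, f y ∂((fun m : Measure Ω => m.bind (indepMH q w))^[k] (ν.map Prod.snd)) with hmk
  have hmean : ∀ j, μ[fun ω => f ((Z j ω k).2)] = mk := fun j => by
    rw [integral_comp_eq_of_map_eq (hZm j) (hlaw j) hFm]
    exact crnLag_integral_snd_eq hw0 Khat hK ν hf hC k
  -- the common second moment about `θ` (transfer of the bounded measurable `(f − θ)²`)
  have hGm : Measurable fun x => (f x - θ) ^ 2 := (hf.sub_const θ).pow_const 2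
  have hGC : ∀ x, |(f x - θ) ^ 2| ≤ (max |a| |c| + |θ|) ^ 2 := fun x => by
    rw [abs_pow]
    refine pow_le_pow_left₀ (abs_nonneg _) ?_ 2
    calc |f x - θ| ≤ |f x| + |θ| := abs_sub _ _
      _ ≤ max |a| |c| + |θ| := add_le_add (hC x) le_rfl
  have hGFm : Measurable fun z : ℕ → Ω × Ω => (f ((z k).2) - θ) ^ 2 := hGm.comp (measurable_snd.comp (measurable_pi_apply k))
  have hQ : ∀ j, μ[fun ω => (f ((Z j ω k).2) - θ) ^ 2] =
      ∫ y, (f y - θ) ^ 2 ∂((fun m : Measure Ω => m.bind (indepMH q w))^[k] (ν.map Prod.snd)) := fun j => by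
    rw [integral_comp_eq_of_map_eq (hZm j) (hlaw j) hGFm]
    exact crnLag_integral_snd_eq hw0 Khat hK ν (f := fun x => (f x - θ) ^ 2) hGm hGC k
  exact empirical_bernstein_certificate (μ := μ) (X := fun j ω => f ((Z j ω k).2)) (fun j => hFm.comp (hZm j))
    (hind.comp (fun _ => _) fun _ => hFm) (fun j ω => ⟨ha _, hc _⟩) hmean hθ hQ hℓ hs hR

/-- **THE EMPIRICAL CERTIFICATE FOR THE COUPLED ESTIMATOR, ABOUT `π f`** (`MeasurableEq Ω`; `w` maximal at `x₀`, `W = w(x₀)`,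
`r = 1 − 1/W`, `p₀ = ν̂(Δᶜ)`): for `θ ∈ [a, c]` fixed, `ℓ ≥ 0`, `s > 0`, `R ≥ 1` and every window `N`,
`P(|R⁻¹Σ_j H_{k,N}(Z_j) − π f| ≥ √(2ℓ(Q̂_R + s)/R) + 2(c − a)ℓ/(3R) + r^k(c − a)) ≤ 2e^{−ℓ} + exp(−Rs²/(2(c − a)⁴)) + R·r^k·p₀`,
`Q̂_R = R⁻¹Σ_j(f(Y_k^{(j)}) − θ)²` computed from the same read-outs. [ours] -/
theorem crnLag_replicas_burnIn_empirical_certificate_target [MeasurableEq Ω] [Fact (Measurable w)] (hw0 : ∀ y, 0 < w y)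
    {x₀ : Ω} (hmax : ∀ y, w y ≤ w x₀) [IsProbabilityMeasure (q.withDensity fun y => ENNReal.ofReal (w y))]
    (Khat : Kernel (Ω × Ω) (Ω × Ω)) [IsMarkovKernel Khat]
    (hK : ∀ z : Ω × Ω, Khat z = (q.prod (volume : Measure unitInterval)).map (fun p : Ω × unitInterval =>
      ((if (p.2 : ℝ) * w z.1 ≤ w p.1 then p.1 else z.1), (if (p.2 : ℝ) * w z.2 ≤ w p.1 then p.1 else z.2))))
    (ν : Measure (Ω × Ω)) [IsProbabilityMeasure ν] {f : Ω → ℝ} (hf : Measurable f) {a c : ℝ} (ha : ∀ x, a ≤ f x)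
    (hc : ∀ x, f x ≤ c) (k N : ℕ) (hZm : ∀ j, Measurable (Z j))
    (hlaw : ∀ j, μ.map (Z j) = Kernel.trajMeasure (X := fun _ : ℕ => Ω × Ω) ν
      (fun n : ℕ => Khat.comap (fun h : (i : ↥(Finset.Iic n)) → Ω × Ω => h ⟨n, Finset.mem_Iic.2 le_rfl⟩)
        (measurable_pi_apply _)))
    (hind : iIndepFun Z μ) {θ : ℝ} (hθ : θ ∈ Set.Icc a c) {ℓ : ℝ} (hℓ : 0 ≤ ℓ) {s : ℝ} (hs : 0 < s) {R : ℕ} (hR : 1 ≤ R) :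
    μ.real {ω | Real.sqrt (2 * ℓ * ((R : ℝ)⁻¹ * ∑ j ∈ range R, (f ((Z j ω k).2) - θ) ^ 2 + s) / R) + 2 * (c - a) * ℓ / (3 * R) +
          (1 - (w x₀)⁻¹) ^ k * (c - a) ≤
        |(R : ℝ)⁻¹ * ∑ j ∈ range R, (f ((Z j ω k).2) + ∑ n ∈ range N, (f ((Z j ω (k + n)).1) - f ((Z j ω (k + n)).2))) -
          ∫ x, f x ∂(q.withDensity fun y => ENNReal.ofReal (w y))|} ≤
      2 * Real.exp (-ℓ) + Real.exp (-(R * s ^ 2) / (2 * (c - a) ^ 4)) + R * ((1 - (w x₀)⁻¹) ^ k * ν.real (Set.diagonal Ω)ᶜ) := by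
  have hw : Measurable w := Fact.out
  haveI : IsProbabilityMeasure (ν.map Prod.snd) := Measure.isProbabilityMeasure_map measurable_snd.aemeasurable
  set mk := ∫ y, f y ∂((fun m : Measure Ω => m.bind (indepMH q w))^[k] (ν.map Prod.snd)) with hmk
  set πf := ∫ x, f x ∂(q.withDensity fun y => ENNReal.ofReal (w y)) with hπf
  set B : Set Ω' := ⋃ j ∈ range R, {ω | ∑ n ∈ range N, (f ((Z j ω (k + n)).1) - f ((Z j ω (k + n)).2)) ≠ 0} with hB
  set ρ : Ω' → ℝ := fun ω => Real.sqrt (2 * ℓ * ((R : ℝ)⁻¹ * ∑ j ∈ range R, (f ((Z j ω k).2) - θ) ^ 2 + s) / R) +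
    2 * (c - a) * ℓ / (3 * R) with hρ
  have hbias : |mk - πf| ≤ (1 - (w x₀)⁻¹) ^ k * (c - a) := integral_iterate_bind_indepMH_abs_le hw hw0 hmax k (ν.map Prod.snd) hf ha hc
  -- off `B` the coupled average is the read-out average; the bias moves the centre from `π f` to `m_k`
  have hsub : {ω | ρ ω + (1 - (w x₀)⁻¹) ^ k * (c - a) ≤
        |(R : ℝ)⁻¹ * ∑ j ∈ range R, (f ((Z j ω k).2) + ∑ n ∈ range N, (f ((Z j ω (k + n)).1) - f ((Z j ω (k + n)).2))) - πf|}
      ⊆ B ∪ {ω | ρ ω ≤ |(R : ℝ)⁻¹ * ∑ j ∈ range R, f ((Z j ω k).2) - mk|} := by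
    intro ω hω
    by_cases hωB : ω ∈ B
    · exact Or.inl hωB
    · right
      have hzero : ∀ j ∈ range R, ∑ n ∈ range N, (f ((Z j ω (k + n)).1) - f ((Z j ω (k + n)).2)) = 0 := by
        intro j hj
        by_contra hne
        exact hωB (Set.mem_biUnion (show j ∈ (range R : Set ℕ) from by exact_mod_cast hj) hne)
      have hsum : ∑ j ∈ range R, (f ((Z j ω k).2) + ∑ n ∈ range N, (f ((Z j ω (k + n)).1) - f ((Z j ω (k + n)).2))) =
          ∑ j ∈ range R, f ((Z j ω k).2) := sum_congr rfl fun j hj => by rw [hzero j hj, add_zero]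
      simp only [Set.mem_setOf_eq] at hω ⊢
      rw [hsum] at hω
      have htri : |(R : ℝ)⁻¹ * ∑ j ∈ range R, f ((Z j ω k).2) - πf| ≤ |(R : ℝ)⁻¹ * ∑ j ∈ range R, f ((Z j ω k).2) - mk| + |mk - πf| :=
        abs_sub_le _ mk πf
      linarith
  have h1 := crnLag_replicas_some_correction_le hw0 hmax Khat hK ν hf ha hc k N hZm hlaw R
  have h2 := crnLag_replicas_readout_empirical_certificate hw0 Khat hK ν hf ha hc k hZm hlaw hind hθ hℓ hs hR
  calc μ.real {ω | ρ ω + (1 - (w x₀)⁻¹) ^ k * (c - a) ≤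
          |(R : ℝ)⁻¹ * ∑ j ∈ range R, (f ((Z j ω k).2) + ∑ n ∈ range N, (f ((Z j ω (k + n)).1) - f ((Z j ω (k + n)).2))) - πf|}
      ≤ μ.real (B ∪ {ω | ρ ω ≤ |(R : ℝ)⁻¹ * ∑ j ∈ range R, f ((Z j ω k).2) - mk|}) := measureReal_mono hsub
    _ ≤ μ.real B + μ.real {ω | ρ ω ≤ |(R : ℝ)⁻¹ * ∑ j ∈ range R, f ((Z j ω k).2) - mk|} := measureReal_union_le _ _
    _ ≤ R * ((1 - (w x₀)⁻¹) ^ k * ν.real (Set.diagonal Ω)ᶜ) + (2 * Real.exp (-ℓ) + Real.exp (-(R * s ^ 2) / (2 * (c - a) ^ 4))) :=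
        add_le_add h1 h2
    _ = 2 * Real.exp (-ℓ) + Real.exp (-(R * s ^ 2) / (2 * (c - a) ^ 4)) + R * ((1 - (w x₀)⁻¹) ^ k * ν.real (Set.diagonal Ω)ᶜ) := by
        ring

end Replicas

end Summit.Ventures.LatticeQCDFlow.Exactness

end
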